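import Summits.QuantumFields.YangMills.Theorems.UnitScaleTiltHalvingCompetitorMapFibreFormula
import Summits.QuantumFields.YangMills.Theorems.UnitScaleTiltHalvingCompetitorMapFibreLocal
import HarnessLib

/-!
# Route `UnitScaleTilt`, crux K1 child «MinimiserStabilityRegPr» (stmt-QuantumFields-19200), registered stub `stub_halvingStep` (H), door v3 (Stat currency),
# row B5 «DIFFERENTIABLE GAUGE FIX» (LEAD ★w5-19200 g4 RULING L-7 (a)), file C of three — **THE DIFFERENTIABLE GAUGE FIX ON A COMPETITOR LINE OF THE CHART**:
# in the letters of ✓B4 `exists_gaugeAct_mem_fibre_of_chart49`, for a competitor LINE `t ↦ W_t` through the chart centre `A` in a `ker Q` direction `Y`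
# (`W_t = e^{iη♭((A+tY) − H(D(A+tY)))}` on `Near`, `= uS • Umin` off `Near`, `|t| < r` inside the `r₁`-ball), ONE `SU(2)` gauge family `t ↦ h_t` with
# (i) `h_t • W_t ∈ 𝔅_k(V)` whenever `W_t` is regular, (ii) `t ↦ ↑(h_t z)` differentiable at every `|t₀| < r`, (iii) `t ↦ ↑(W_t b)` differentiable at every `|t₀| < r`

Cell `ym3-torus` (HUMAN RULING D-0037, YM ladder rung R3 — continuum SU(2) YM₃ on the torus is a RUNG, not the Clay problem), width seat `ym-ust-19200-w1` gen 8.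
`--supports stmt-QuantumFields-19200 --as helper`; def-free, 0 sorry, standard axioms; counts toward nothing by itself.

WHY ∕ HOW.  L-7 (a)'s cost row: door v3's Stat clause quantifies over bondwise-differentiable EXACT-fibre curves, so the L4-Stat writer needs the competitor line gauge-fixed
into the fibre DIFFERENTIABLY (then ✓`HalvingCompetitorMapFibreStat.deriv_wilsonAction_line_eq_zero_of_stat` turns Stat(`Umin`) into the FILE-A-twin input
`deriv (t ↦ 𝒲(W_t)) 0 = 0`).  The gauge is file B's selector `hOf` (B3's explicit gauge); its values are file B's formula `Gm` of the UNITS reading of the competitor, which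
extends to COMPLEX parameters `τ` as the units field `Wu τ := e^{iη♭((A+τY) − H(D(A+τY)))}` on `Near`, `uS • Umin` off it — bondwise ℂ-differentiable (`D` is on the
ball), index-pinned to `uS • Umin` for every `τ` with `A + τY` in the ball (B4 §2–§3's pinning argument never used self-adjointness: (49) + `hHinv` + `Q Y = 0` + locality +
`exp ∘ log = id`), near-flat under the `Ω`-blocks — so file B (b) gives ℂ-differentiability of `τ ↦ Gm (Wu τ) z`, restricted to real `t` through `t ↦ (t : ℂ)`.

WHAT IS PROVED (ns `…Theorems.HalvingCompetitorMapFibreSmooth`).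
* ★★★ `exists_smoothGauge_mem_fibre_of_chart49_line` — B4 §3's binder list with the single competitor replaced by the line data (`Y` with `bondAvgIter Y = 0` on `BondIdx Dm`,
  radius `r` keeping `A + tY` in the `r₁`-ball, `hDd` = `D` ℂ-differentiable on the ball (L2″'s letter), the line `Wl` with `hWnear` for `|t| < r` and `hWfar`), concluding
  `∃ hl : ℝ → GaugeTransf …, (∀ t, |t| < r → RegPr ε₀ (Wl t) → hl t • Wl t ∈ fibre … V) ∧ (∀ t₀, |t₀| < r → ∀ z, DifferentiableAt ℝ (t ↦ ↑(hl t z)) t₀) ∧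
  (∀ t₀, |t₀| < r → ∀ b, DifferentiableAt ℝ (t ↦ ↑(Wl t b)) t₀)`.
HONEST SCOPE: assembly over files A∕B + B4's pinning steps; `Near` clauses, membership, chart identity displayed as in B4; NOT a claim about the stub, the crux, the rung or a gap.

References: T. Bałaban, CMP **102** (1985) 277–309 [Balaban1985Variational] ((3)–(4), (6) p.278, (20) p.281, (44)–(49) p.285, (150) p.301, (152) p.301, (156)–(158) p.302);
CMP **98** (1985) 17–51 [Balaban1985Averaging] ((89) p.31, (110) p.34, (134)–(135) p.38); CMP **96** (1984) 223–250 [Balaban1984PropagatorsII] ((2.1)–(2.4) p.224).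
-/

set_option autoImplicit false

noncomputable section

open scoped BigOperators Matrix.Norms.L2Operator Topology
open NormedSpace Filter

namespace Summit.QuantumFields.YangMills.Theorems.HalvingCompetitorMapFibreSmooth

open Literature.MathematicalPhysics.QuantumFieldTheory.Balaban1983to89
open Literature.MathematicalPhysics.QuantumFieldTheory.Balaban1983to89.T3ContinuumYM3Torus
open Literature.MathematicalPhysics.QuantumFieldTheory.Balaban1983to89.T3UnitLawDensityEML (ℰp)
open Literature.MathematicalPhysics.QuantumFieldTheory.Balaban1983to89.T3TiltDescent (descendTo)
open Literature.MathematicalPhysics.QuantumFieldTheory.Balaban1983to89.T3ConstrainedMinimiser (fibre)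
open Literature.MathematicalPhysics.QuantumFieldTheory.Balaban1983to89.T3RegularMinimiser (regThreshold)
open Literature.MathematicalPhysics.QuantumFieldTheory.Balaban1983to89.T3PrintedRegularMinimiser (RegPr regFibrePr mem_regFibrePr_iff)
open T4Continuum BlockAveraging ExpMeanLog
open MatrixLog (mlog exp_mlog)
open B10Eq27TorusAxialLog (unitsField val_unitsField toUField suIncl val_suIncl)
open B5Eq118OneStroke (iterBlockOf)
open B6SectADomainsV1 (Domains)
open B6SectAOperatorsV1 (BondIdx)
open B11Eq115Space (levOf le_levOf)
open LatticeFieldCalculus (bondAvgIter)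
open B5Eq120IterProof (bondAvgIter_zero)
open FlatCubeOpsText (IsLevWeight)
open Summit.QuantumFields.YangMills.Theorems.Prop8Chart (expCfg coe_expCfg differentiableAt_coe_expCfg)
open Summit.QuantumFields.YangMills.Theorems.Prop8ChartDoubleBar (dbarIterU dbarIterU_zero dbarIterU_congr_of_agree norm_dbarIterU_sub_one_le_two_mul₀ chartLogFlat
  chartLogFlat_apply fderiv_chartLogFlat_zero_apply)
open Summit.QuantumFields.YangMills.Theorems.HalvingCompetitorMapFibreLocal (coe_unitsField_toUField chartLogFlat_dressed_eq)
open Summit.QuantumFields.YangMills.Theorems.HalvingCompetitorMapFibreFormula (exists_gaugeOf_mem_fibre_smooth)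

variable (F : T3Family) (n K : ℕ)

-- heartbeat budget (HOME README rule): a 40-binder signature and a B4-sized pinning derivation; budgeted on this declaration only
set_option maxHeartbeats 400000 in
/-- ★★★ **THE DIFFERENTIABLE GAUGE FIX ON A COMPETITOR LINE** — see the module docstring.  Letters = ✓B4 `exists_gaugeAct_mem_fibre_of_chart49` (nested family `Dm`, `Dm.k = K − n`,
collar, level weights `w`, chart radius `R`, `H`, `D`, (49) `h49`, `hHinv`, `hball`, centre `A` in the `r₁`-ball, `Umin ∈ regFibrePr … ε₀ V`, `0 < ε₀`, `10⁷L³ε₀ ≤ 1`, `uS`, `Near` with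
its two containment clauses, the chart identity `hchartNear`) + the LINE: direction `Y` with `bondAvgIter Y = 0` on `BondIdx Dm`, `A + tY` in the `r₁`-ball for
`|t| < r`, `D` ℂ-differentiable on the ball, `Wl : ℝ → SU(2)^{bonds}` equal to `e^{iη♭((A+tY) − H(D(A+tY)))}` on `Near` for `|t| < r` and to `uS • Umin` off `Near`.
[cite: Balaban1985Variational, (3)-(4) p.278, (44)-(49) p.285, (150) p.301, (152) p.301, (156)-(158) p.302; Balaban1985Averaging, (89) p.31, (134)-(135) p.38;
Balaban1984PropagatorsII, (2.3)-(2.4) p.224] -/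
theorem exists_smoothGauge_mem_fibre_of_chart49_line (Dm : Domains (F.P K)) (hDk : Dm.k = K - n)
    (hcollar : ∀ (i : ℕ) (e : PBond (F.P K) (i + 1)), Dm.LamBond (i + 1) e → ∀ z : Site (F.P K) i, (blockOf z = e.src ∨ blockOf z = e.tgt) → z ∈ Dm.Om i)
    {w : ℕ → PBond (F.P K) 0 → ℝ} (hw : IsLevWeight F n K Dm w)
    {R : ℝ} (hR : 16 * 3800 * ((((F.P K).d + 2) * (F.P K).L : ℕ) : ℝ) ^ 2 * (F.L : ℝ) * R ≤ 1)
    (H : (BondIdx Dm → Matrix (Fin 2) (Fin 2) ℂ) →ₗ[ℂ] (PBond (F.P K) 0 → Matrix (Fin 2) (Fin 2) ℂ))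
    (D : (PBond (F.P K) 0 → Matrix (Fin 2) (Fin 2) ℂ) → (BondIdx Dm → Matrix (Fin 2) (Fin 2) ℂ))
    {r₁ : ℝ}
    (h49 : ∀ X : PBond (F.P K) 0 → Matrix (Fin 2) (Fin 2) ℂ, (∀ b, w 1 b * ‖X b‖ < r₁) → (fun (Z : PBond (F.P K) 0 → Matrix (Fin 2) (Fin 2) ℂ) =>
      chartLogFlat ((((F.L : ℝ))⁻¹) ^ (K - n)) Dm Z - (fderiv ℂ (chartLogFlat ((((F.L : ℝ))⁻¹) ^ (K - n)) Dm : (PBond (F.P K) 0 → Matrix (Fin 2) (Fin 2) ℂ) →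
        BondIdx Dm → Matrix (Fin 2) (Fin 2) ℂ) 0) Z) (X - H (D X)) = D X)
    (hHinv : ∀ Y : BondIdx Dm → Matrix (Fin 2) (Fin 2) ℂ, (fderiv ℂ (chartLogFlat ((((F.L : ℝ))⁻¹) ^ (K - n)) Dm : (PBond (F.P K) 0 → Matrix (Fin 2) (Fin 2) ℂ) →
      BondIdx Dm → Matrix (Fin 2) (Fin 2) ℂ) 0) (H Y) = Y)
    (hball : ∀ X : PBond (F.P K) 0 → Matrix (Fin 2) (Fin 2) ℂ, (∀ b, w 1 b * ‖X b‖ < r₁) → ∀ b, w 1 b * ‖(X - H (D X)) b‖ < R)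
    (hDd : ∀ X : PBond (F.P K) 0 → Matrix (Fin 2) (Fin 2) ℂ, (∀ b, w 1 b * ‖X b‖ < r₁) → DifferentiableAt ℂ D X)
    {A : PBond (F.P K) 0 → Matrix (Fin 2) (Fin 2) ℂ} (hAS : ∀ b, w 1 b * ‖A b‖ < r₁)
    {Y : PBond (F.P K) 0 → Matrix (Fin 2) (Fin 2) ℂ} (hYQ : ∀ c : BondIdx Dm, bondAvgIter (c.1.1 : ℕ) Y c.1.2 = 0)
    {r : ℝ} (hrS : ∀ t : ℝ, |t| < r → ∀ b, w 1 b * ‖(A + t • Y) b‖ < r₁)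
    (hnK : n ≤ K) {ε₀ : ℝ} (hε₀ : 0 < ε₀) (hε : 10 ^ 7 * (F.L : ℝ) ^ 3 * ε₀ ≤ 1)
    {V : GaugeField (F.P n) 0 (Matrix.specialUnitaryGroup (Fin 2) ℂ)} {Umin : GaugeField (F.P K) 0 (Matrix.specialUnitaryGroup (Fin 2) ℂ)}
    (hUmin : Umin ∈ regFibrePr F n K hnK ε₀ V) (uS : GaugeTransf (F.P K) 0 (Matrix.specialUnitaryGroup (Fin 2) ℂ))
    (Near : PBond (F.P K) 0 → Prop)
    (hNearIdx : ∀ idx : BondIdx Dm, 1 ≤ (idx.1.1 : ℕ) → ∀ b : PBond (F.P K) 0,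
      (iterBlockOf (idx.1.1 : ℕ) b.src = idx.1.2.src ∨ iterBlockOf (idx.1.1 : ℕ) b.src = idx.1.2.tgt) →
      (iterBlockOf (idx.1.1 : ℕ) b.tgt = idx.1.2.src ∨ iterBlockOf (idx.1.1 : ℕ) b.tgt = idx.1.2.tgt) → Near b)
    (hNearΩ : ∀ (j : ℕ) (z : Site (F.P K) (j + 1)), z ∈ Dm.Om (j + 1) → ∀ b : PBond (F.P K) 0, iterBlockOf (j + 1) b.src = z → iterBlockOf (j + 1) b.tgt = z → Near b)
    (hchartNear : ∀ b, Near b → ((GaugeField.gaugeAct uS Umin b : Matrix.specialUnitaryGroup (Fin 2) ℂ) : Matrix (Fin 2) (Fin 2) ℂ) =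
      exp ((Complex.I * ((((F.L : ℝ))⁻¹ ^ (K - n) : ℝ) : ℂ)) • (A - H (D A)) b))
    (Wl : ℝ → GaugeField (F.P K) 0 (Matrix.specialUnitaryGroup (Fin 2) ℂ))
    (hWnear : ∀ t : ℝ, |t| < r → ∀ b, Near b → ((Wl t b : Matrix.specialUnitaryGroup (Fin 2) ℂ) : Matrix (Fin 2) (Fin 2) ℂ) =
      exp ((Complex.I * ((((F.L : ℝ))⁻¹ ^ (K - n) : ℝ) : ℂ)) • ((A + t • Y) - H (D (A + t • Y))) b))
    (hWfar : ∀ (t : ℝ) (b : PBond (F.P K) 0), ¬ Near b → Wl t b = GaugeField.gaugeAct uS Umin b) :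
    ∃ hl : ℝ → GaugeTransf (F.P K) 0 (Matrix.specialUnitaryGroup (Fin 2) ℂ),
      (∀ t : ℝ, |t| < r → RegPr F n K ε₀ (Wl t) → GaugeField.gaugeAct (hl t) (Wl t) ∈ fibre F ℰp n K hnK V) ∧
      (∀ t₀ : ℝ, |t₀| < r → ∀ z : Site (F.P K) 0,
        DifferentiableAt ℝ (fun t : ℝ => ((hl t z : Matrix.specialUnitaryGroup (Fin 2) ℂ) : Matrix (Fin 2) (Fin 2) ℂ)) t₀) ∧
      (∀ t₀ : ℝ, |t₀| < r → ∀ b : PBond (F.P K) 0,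
        DifferentiableAt ℝ (fun t : ℝ => ((Wl t b : Matrix.specialUnitaryGroup (Fin 2) ℂ) : Matrix (Fin 2) (Fin 2) ℂ)) t₀) := by
  classical
  have hL1 : (1 : ℝ) ≤ (F.L : ℝ) := by exact_mod_cast F.hL.2.le
  have hL0 : (0 : ℝ) < (F.L : ℝ) := by linarith
  have hLne : (F.L : ℝ) ≠ 0 := hL0.ne'
  have hη0 : 0 ≤ ((F.L : ℝ))⁻¹ ^ (K - n) := pow_nonneg (inv_nonneg.2 hL0.le) _
  have hηne : ((((F.L : ℝ))⁻¹ ^ (K - n) : ℝ) : ℂ) ≠ 0 := by exact_mod_cast (pow_pos (inv_pos.2 hL0) (K - n)).ne'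
  have hLinv0 : 0 ≤ ((F.L : ℝ))⁻¹ := inv_nonneg.2 hL0.le
  have hLinv1 : ((F.L : ℝ))⁻¹ ≤ 1 := inv_le_one_of_one_le₀ hL1
  have hLj : ∀ j : ℕ, (F.L : ℝ) ^ j * ((F.L : ℝ))⁻¹ ^ j = 1 := fun j => by rw [← mul_pow, mul_inv_cancel₀ hLne, one_pow]
  have hR0 : 0 ≤ max R 0 := le_max_right _ _
  have hc : (1 : ℝ) ≤ ((((F.P K).d + 2) * (F.P K).L : ℕ) : ℝ) := by exact_mod_cast Nat.succ_le_of_lt (Nat.mul_pos (by omega) (F.P K).L_pos)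
  have hℓ1 : (1 : ℝ) ≤ ((((F.P K).d + 2) * (F.P K).L : ℕ) : ℝ) ^ 2 := one_le_pow₀ hc
  have hR' : 16 * 3800 * ((((F.P K).d + 2) * (F.P K).L : ℕ) : ℝ) ^ 2 * (F.L : ℝ) * max R 0 ≤ 1 := by
    rcases le_total 0 R with h | h
    · rwa [max_eq_left h]
    · rw [max_eq_right h, mul_zero]; exact zero_le_one
  have hLR : 60800 * ((F.L : ℝ) * max R 0) ≤ 1 := by
    nlinarith [mul_le_mul_of_nonneg_left hℓ1 (by positivity : (0 : ℝ) ≤ 60800 * ((F.L : ℝ) * max R 0))]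
  have hR1 : max R 0 ≤ 1 := by nlinarith [le_mul_of_one_le_left hR0 hL1]
  -- (a) the weight floor and the window `R ≤ 1/5`
  have hwfloor : ∀ b : PBond (F.P K) 0, ((F.L : ℝ))⁻¹ ^ (K - n) ≤ w 1 b := fun b => by
    rw [hw 1 b, pow_one]
    exact le_mul_of_one_le_left hη0 (one_le_pow₀ hL1)
  have hR5 : R ≤ 1 / 5 := by
    by_cases hR0' : R ≤ 0
    · linarith
    have hc2 : (1 : ℝ) ≤ ((((F.P K).d + 2) * (F.P K).L : ℕ) : ℝ) ^ 2 * (F.L : ℝ) := one_le_mul_of_one_le_of_one_le hℓ1 hL1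
    have h1 : 16 * 3800 * R ≤ 16 * 3800 * ((((F.P K).d + 2) * (F.P K).L : ℕ) : ℝ) ^ 2 * (F.L : ℝ) * R := by nlinarith
    linarith
  -- (b) the log-chart data of a dressed field in the ball are its linear data
  have hkey : ∀ X : PBond (F.P K) 0 → Matrix (Fin 2) (Fin 2) ℂ, (∀ b, w 1 b * ‖X b‖ < r₁) → chartLogFlat ((((F.L : ℝ))⁻¹) ^ (K - n)) Dm (X - H (D X)) =
      (fderiv ℂ (chartLogFlat ((((F.L : ℝ))⁻¹) ^ (K - n)) Dm : (PBond (F.P K) 0 → Matrix (Fin 2) (Fin 2) ℂ) → BondIdx Dm → Matrix (Fin 2) (Fin 2) ℂ) 0) X :=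
    fun X hX => chartLogFlat_dressed_eq Dm _ H D hHinv (h49 X hX)
  -- (c) the level-0 dressing vanishes on the ball
  have hZ : ∀ X : PBond (F.P K) 0 → Matrix (Fin 2) (Fin 2) ℂ, (∀ b, w 1 b * ‖X b‖ < r₁) → ∀ (b : PBond (F.P K) 0), Dm.LamBond 0 b → (X - H (D X)) b = X b := by
    intro X hX b hb
    have hsmall : ‖((((((F.L : ℝ))⁻¹ ^ (K - n) : ℝ)) : ℂ) • (X - H (D X))) b‖ ≤ 1 / 5 := by
      rw [Pi.smul_apply, norm_smul, Complex.norm_real, Real.norm_of_nonneg hη0]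
      have h1 : ((F.L : ℝ))⁻¹ ^ (K - n) * ‖(X - H (D X)) b‖ ≤ w 1 b * ‖(X - H (D X)) b‖ := mul_le_mul_of_nonneg_right (hwfloor b) (norm_nonneg _)
      linarith [hball X hX b]
    have h := congr_fun (hkey X hX) ⟨⟨⟨0, Nat.succ_pos _⟩, b⟩, hb⟩
    rw [chartLogFlat_apply, fderiv_chartLogFlat_zero_apply] at h
    have h' : (-Complex.I) • mlog (((dbarIterU 0 (expCfg (((F.L : ℝ))⁻¹ ^ (K - n)) (X - H (D X)))) b : (Matrix (Fin 2) (Fin 2) ℂ)ˣ) : Matrix (Fin 2) (Fin 2) ℂ) =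
        ((((((F.L : ℝ))⁻¹ ^ (K - n) : ℝ)) : ℂ) * (((F.P K).L : ℕ) : ℂ) ^ (0 : ℕ)) • bondAvgIter 0 X b := h
    rw [ChartKernelFlat.logTower_zero _ _ b hsmall, pow_zero, mul_one, bondAvgIter_zero, Pi.smul_apply] at h'
    exact smul_right_injective (Matrix (Fin 2) (Fin 2) ℂ) hηne h'
  -- the complex competitor line, its dressing, the charted units field along it
  let Xc : ℂ → PBond (F.P K) 0 → Matrix (Fin 2) (Fin 2) ℂ := fun τ => A + τ • Y
  let Zc : ℂ → PBond (F.P K) 0 → Matrix (Fin 2) (Fin 2) ℂ := fun τ => Xc τ - H (D (Xc τ))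
  let Wu : ℂ → GaugeField (F.P K) 0 (Matrix (Fin 2) (Fin 2) ℂ)ˣ := fun τ b =>
    if Near b then expCfg (((F.L : ℝ))⁻¹ ^ (K - n)) (Zc τ) b else unitsField (toUField (GaugeField.gaugeAct uS Umin)) b
  have hWu_near : ∀ τ b, Near b → Wu τ b = expCfg (((F.L : ℝ))⁻¹ ^ (K - n)) (Zc τ) b := fun τ b hb => if_pos hb
  have hWu_far : ∀ τ b, ¬ Near b → Wu τ b = unitsField (toUField (GaugeField.gaugeAct uS Umin)) b := fun τ b hb => if_neg hb
  have hAu : ∀ b, Near b → unitsField (toUField (GaugeField.gaugeAct uS Umin)) b = expCfg (((F.L : ℝ))⁻¹ ^ (K - n)) (A - H (D A)) b := fun b hb =>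
    Units.ext (by rw [coe_unitsField_toUField, coe_expCfg]; exact hchartNear b hb)
  have hXc_real : ∀ t : ℝ, Xc (t : ℂ) = A + t • Y := fun t => by
    show A + (t : ℂ) • Y = A + t • Y
    rw [Complex.coe_smul]
  have hZc_real : ∀ t : ℝ, Zc (t : ℂ) = (A + t • Y) - H (D (A + t • Y)) := fun t => by
    show Xc (t : ℂ) - H (D (Xc (t : ℂ))) = _
    rw [hXc_real]
  have hWlu : ∀ t : ℝ, |t| < r → unitsField (toUField (Wl t)) = Wu (t : ℂ) := by
    intro t ht
    funext b
    by_cases hb : Near b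
    · rw [hWu_near _ b hb]
      apply Units.ext
      rw [coe_unitsField_toUField, coe_expCfg, hWnear t ht b hb, hZc_real]
    · rw [hWu_far _ b hb]
      apply Units.ext
      rw [coe_unitsField_toUField, coe_unitsField_toUField, hWfar t b hb]
  -- «good» parameters: the complex competitor in the `r₁`-ball; the real segment is good, and good is open
  have hgood_real : ∀ t : ℝ, |t| < r → ∀ b, w 1 b * ‖Xc (t : ℂ) b‖ < r₁ := fun t ht b => by rw [hXc_real]; exact hrS t ht b
  have hgood_open : IsOpen {τ : ℂ | ∀ b, w 1 b * ‖Xc τ b‖ < r₁} := by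
    have hset : {τ : ℂ | ∀ b, w 1 b * ‖Xc τ b‖ < r₁} = ⋂ b, {τ : ℂ | w 1 b * ‖Xc τ b‖ < r₁} := by ext τ; simp
    rw [hset]
    refine isOpen_iInter_of_finite fun b => isOpen_lt (continuous_const.mul (Continuous.norm ?_)) continuous_const
    show Continuous fun τ : ℂ => (A + τ • Y) b
    exact ((continuous_apply b).comp (continuous_const.add (continuous_id.smul continuous_const)))
  -- (d) along good parameters: equal log-chart data at the indices of level `≥ 1`, equal dressed values on `Λ₀`
  have hfd0 : ∀ idx : BondIdx Dm, (fderiv ℂ (chartLogFlat ((((F.L : ℝ))⁻¹) ^ (K - n)) Dm : (PBond (F.P K) 0 → Matrix (Fin 2) (Fin 2) ℂ) →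
      BondIdx Dm → Matrix (Fin 2) (Fin 2) ℂ) 0) Y idx = 0 := fun idx => by
    rw [fderiv_chartLogFlat_zero_apply, hYQ idx, smul_zero]
  have hlogτ : ∀ τ : ℂ, (∀ b, w 1 b * ‖Xc τ b‖ < r₁) → ∀ idx : BondIdx Dm,
      chartLogFlat (((F.L : ℝ))⁻¹ ^ (K - n)) Dm (Zc τ) idx = chartLogFlat (((F.L : ℝ))⁻¹ ^ (K - n)) Dm (A - H (D A)) idx := fun τ hτ idx => by
    show chartLogFlat (((F.L : ℝ))⁻¹ ^ (K - n)) Dm (Xc τ - H (D (Xc τ))) idx = _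
    rw [hkey (Xc τ) hτ, hkey A hAS]
    show (fderiv ℂ (chartLogFlat ((((F.L : ℝ))⁻¹) ^ (K - n)) Dm : (PBond (F.P K) 0 → Matrix (Fin 2) (Fin 2) ℂ) → BondIdx Dm → Matrix (Fin 2) (Fin 2) ℂ) 0)
      (A + τ • Y) idx = _
    rw [map_add, map_smul, Pi.add_apply, Pi.smul_apply, hfd0 idx, smul_zero, add_zero]
  have hY0 : ∀ (b : PBond (F.P K) 0), Dm.LamBond 0 b → Y b = 0 := fun b hb => by
    simpa only [bondAvgIter_zero] using hYQ ⟨⟨⟨0, Nat.succ_pos _⟩, b⟩, hb⟩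
  have hZ0τ : ∀ τ : ℂ, (∀ b, w 1 b * ‖Xc τ b‖ < r₁) → ∀ b : PBond (F.P K) 0, Dm.LamBond 0 b → Zc τ b = (A - H (D A)) b := fun τ hτ b hb => by
    show (Xc τ - H (D (Xc τ))) b = _
    rw [hZ (Xc τ) hτ b hb, hZ A hAS b hb]
    show (A + τ • Y) b = A b
    rw [Pi.add_apply, Pi.smul_apply, hY0 b hb, smul_zero, add_zero]
  -- (e) the chart bound under `Ω_j`: `‖e^{iη♭Z(b)} − 1‖ ≤ 2R⁺L^{−j}`
  have hchart : ∀ (j : ℕ), j ≤ K - n → ∀ (Z : PBond (F.P K) 0 → Matrix (Fin 2) (Fin 2) ℂ), (∀ b, w 1 b * ‖Z b‖ < R) →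
      ∀ b : PBond (F.P K) 0, Dm.InOm j b.src →
        ‖exp ((Complex.I * ((((F.L : ℝ))⁻¹ ^ (K - n) : ℝ) : ℂ)) • Z b) - 1‖ ≤ 2 * (max R 0 * ((F.L : ℝ))⁻¹ ^ j) := by
    intro j hj Z hZR b hb
    have hwb : ((F.L : ℝ))⁻¹ ^ (K - n) * (F.L : ℝ) ^ j ≤ w 1 b := by
      rw [hw 1 b, pow_one, mul_comm]
      exact mul_le_mul_of_nonneg_right (pow_le_pow_right₀ hL1 (le_levOf (Ω := fun j => {x : Site (F.P K) 0 | Dm.InOm j x}) hj hb)) hη0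
    have hnorm : ‖(Complex.I * ((((F.L : ℝ))⁻¹ ^ (K - n) : ℝ) : ℂ)) • Z b‖ = ((F.L : ℝ))⁻¹ ^ (K - n) * ‖Z b‖ := by
      rw [norm_smul, norm_mul, Complex.norm_I, one_mul, Complex.norm_real, Real.norm_of_nonneg hη0]
    have h1 : ((F.L : ℝ))⁻¹ ^ (K - n) * ‖Z b‖ ≤ ((F.L : ℝ))⁻¹ ^ j * (w 1 b * ‖Z b‖) := by
      have h2 : ((F.L : ℝ))⁻¹ ^ j * (((F.L : ℝ))⁻¹ ^ (K - n) * (F.L : ℝ) ^ j * ‖Z b‖) =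
          ((F.L : ℝ))⁻¹ ^ (K - n) * ‖Z b‖ * ((F.L : ℝ) ^ j * ((F.L : ℝ))⁻¹ ^ j) := by ring
      rw [hLj, mul_one] at h2
      rw [← h2]
      exact mul_le_mul_of_nonneg_left (mul_le_mul_of_nonneg_right hwb (norm_nonneg _)) (pow_nonneg hLinv0 _)
    have h3 : w 1 b * ‖Z b‖ ≤ max R 0 := (hZR b).le.trans (le_max_left _ _)
    have hα : ‖(Complex.I * ((((F.L : ℝ))⁻¹ ^ (K - n) : ℝ) : ℂ)) • Z b‖ ≤ max R 0 * ((F.L : ℝ))⁻¹ ^ j := by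
      rw [hnorm]
      calc ((F.L : ℝ))⁻¹ ^ (K - n) * ‖Z b‖ ≤ ((F.L : ℝ))⁻¹ ^ j * (w 1 b * ‖Z b‖) := h1
        _ ≤ ((F.L : ℝ))⁻¹ ^ j * max R 0 := mul_le_mul_of_nonneg_left h3 (pow_nonneg hLinv0 _)
        _ = max R 0 * ((F.L : ℝ))⁻¹ ^ j := mul_comm _ _
    have hα1 : max R 0 * ((F.L : ℝ))⁻¹ ^ j ≤ 1 := (mul_le_of_le_one_right hR0 (pow_le_one₀ hLinv0 hLinv1)).trans hR1
    exact (B7TransferAnalyticMean.norm_exp_sub_one_le_two_mul (hα.trans hα1)).trans (mul_le_mul_of_nonneg_left hα zero_le_two)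
  -- (f) INDEX PINNING along good parameters (B4 §2's argument on the units field `Wu τ`)
  have hidxτ : ∀ τ : ℂ, (∀ b, w 1 b * ‖Xc τ b‖ < r₁) → ∀ idx : BondIdx Dm,
      dbarIterU (idx.1.1 : ℕ) (Wu τ) idx.1.2 = dbarIterU (idx.1.1 : ℕ) (unitsField (toUField (GaugeField.gaugeAct uS Umin))) idx.1.2 := by
    intro τ hτ idx
    have hZXR : ∀ b, w 1 b * ‖Zc τ b‖ < R := hball (Xc τ) hτ
    have hZAR : ∀ b, w 1 b * ‖(A - H (D A)) b‖ < R := hball A hAS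
    obtain ⟨⟨⟨i, hi⟩, c⟩, hcL⟩ := idx
    show dbarIterU i (Wu τ) c = dbarIterU i (unitsField (toUField (GaugeField.gaugeAct uS Umin))) c
    rcases i with _ | i
    · -- level 0: values
      rw [dbarIterU_zero, dbarIterU_zero]
      by_cases hN : Near c
      · rw [hWu_near τ c hN, hAu c hN]
        apply Units.ext
        rw [coe_expCfg, coe_expCfg, hZ0τ τ hτ c hcL]
      · exact hWu_far τ c hN
    · -- level i+1: locality, the ball, `exp ∘ mlog = id`
      have hi' : i + 1 ≤ Dm.k := by omega
      have hiK : i + 1 ≤ (F.P K).m + (F.P K).K := hi'.trans Dm.hk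
      have hikn : i ≤ K - n := by omega
      let idx : BondIdx Dm := ⟨⟨⟨i + 1, hi⟩, c⟩, hcL⟩
      have hread : ∀ b : PBond (F.P K) 0, (iterBlockOf (i + 1) b.src = c.src ∨ iterBlockOf (i + 1) b.src = c.tgt) →
          (iterBlockOf (i + 1) b.tgt = c.src ∨ iterBlockOf (i + 1) b.tgt = c.tgt) → Near b := hNearIdx idx (Nat.le_add_left 1 i)
      have hW' : dbarIterU (i + 1) (Wu τ) c = dbarIterU (i + 1) (expCfg (((F.L : ℝ))⁻¹ ^ (K - n)) (Zc τ)) c :=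
        dbarIterU_congr_of_agree (i + 1) hiK c fun b hs ht => hWu_near τ b (hread b hs ht)
      have hA' : dbarIterU (i + 1) (unitsField (toUField (GaugeField.gaugeAct uS Umin))) c = dbarIterU (i + 1) (expCfg (((F.L : ℝ))⁻¹ ^ (K - n)) (A - H (D A))) c :=
        dbarIterU_congr_of_agree (i + 1) hiK c fun b hs ht => hAu b (hread b hs ht)
      rw [hW', hA']
      have hsmall : ∀ Z : PBond (F.P K) 0 → Matrix (Fin 2) (Fin 2) ℂ, (∀ b, w 1 b * ‖Z b‖ < R) →
          ‖((dbarIterU (i + 1) (expCfg (((F.L : ℝ))⁻¹ ^ (K - n)) Z) c : (Matrix (Fin 2) (Fin 2) ℂ)ˣ) : Matrix (Fin 2) (Fin 2) ℂ) - 1‖ < 1 := by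
        intro Z hZR
        have hs₀ : (0 : ℝ) ≤ 2 * (max R 0 * ((F.L : ℝ))⁻¹ ^ i) := by positivity
        have hbud : 8 * 3800 * ((((F.P K).d + 2) * (F.P K).L : ℕ) : ℝ) ^ 2 * ((F.P K).L : ℝ) ^ (i + 1) * (2 * (max R 0 * ((F.L : ℝ))⁻¹ ^ i)) ≤ 1 := by
          show 8 * 3800 * ((((F.P K).d + 2) * (F.P K).L : ℕ) : ℝ) ^ 2 * (F.L : ℝ) ^ (i + 1) * (2 * (max R 0 * ((F.L : ℝ))⁻¹ ^ i)) ≤ 1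
          have h1 : 8 * 3800 * ((((F.P K).d + 2) * (F.P K).L : ℕ) : ℝ) ^ 2 * (F.L : ℝ) ^ (i + 1) * (2 * (max R 0 * ((F.L : ℝ))⁻¹ ^ i)) =
              16 * 3800 * ((((F.P K).d + 2) * (F.P K).L : ℕ) : ℝ) ^ 2 * (F.L : ℝ) * max R 0 * ((F.L : ℝ) ^ i * ((F.L : ℝ))⁻¹ ^ i) := by ring
          rw [h1, hLj, mul_one]
          exact hR'
        have hU : ∀ b : PBond (F.P K) 0, iterBlockOf (i + 1) b.src ∈ {y : Site (F.P K) (i + 1) | y = c.src ∨ y = c.tgt} →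
            iterBlockOf (i + 1) b.tgt ∈ {y : Site (F.P K) (i + 1) | y = c.src ∨ y = c.tgt} →
            ‖((expCfg (((F.L : ℝ))⁻¹ ^ (K - n)) Z b : (Matrix (Fin 2) (Fin 2) ℂ)ˣ) : Matrix (Fin 2) (Fin 2) ℂ) - 1‖ ≤ 2 * (max R 0 * ((F.L : ℝ))⁻¹ ^ i) := by
          intro b hs _
          have hIn : Dm.InOm i b.src := hcollar i c hcL (iterBlockOf i b.src) hs
          rw [coe_expCfg]
          exact hchart i hikn Z hZR b hIn
        have h := norm_dbarIterU_sub_one_le_two_mul₀ hiK {y : Site (F.P K) (i + 1) | y = c.src ∨ y = c.tgt} (expCfg (((F.L : ℝ))⁻¹ ^ (K - n)) Z) hs₀ hbud hU c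
          (Or.inl rfl) (Or.inr rfl)
        have h2 : 2 * (((F.P K).L : ℝ) ^ (i + 1) * (2 * (max R 0 * ((F.L : ℝ))⁻¹ ^ i))) = 4 * ((F.L : ℝ) * max R 0) * ((F.L : ℝ) ^ i * ((F.L : ℝ))⁻¹ ^ i) := by
          show 2 * ((F.L : ℝ) ^ (i + 1) * (2 * (max R 0 * ((F.L : ℝ))⁻¹ ^ i))) = _
          ring
        rw [h2, hLj, mul_one] at h
        linarith
      have hl : (-Complex.I) • mlog (((dbarIterU (i + 1) (expCfg (((F.L : ℝ))⁻¹ ^ (K - n)) (Zc τ)) c : (Matrix (Fin 2) (Fin 2) ℂ)ˣ) : Matrix (Fin 2) (Fin 2) ℂ)) =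
          (-Complex.I) • mlog (((dbarIterU (i + 1) (expCfg (((F.L : ℝ))⁻¹ ^ (K - n)) (A - H (D A))) c : (Matrix (Fin 2) (Fin 2) ℂ)ˣ) : Matrix (Fin 2) (Fin 2) ℂ)) := by
        have h := hlogτ τ hτ idx
        rw [chartLogFlat_apply, chartLogFlat_apply] at h
        exact h
      have hl' := smul_right_injective (Matrix (Fin 2) (Fin 2) ℂ) (neg_ne_zero.2 Complex.I_ne_zero) hl
      apply Units.ext
      calc ((dbarIterU (i + 1) (expCfg (((F.L : ℝ))⁻¹ ^ (K - n)) (Zc τ)) c : (Matrix (Fin 2) (Fin 2) ℂ)ˣ) : Matrix (Fin 2) (Fin 2) ℂ)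
          = exp (mlog (((dbarIterU (i + 1) (expCfg (((F.L : ℝ))⁻¹ ^ (K - n)) (Zc τ)) c : (Matrix (Fin 2) (Fin 2) ℂ)ˣ) : Matrix (Fin 2) (Fin 2) ℂ))) :=
            (exp_mlog (hsmall (Zc τ) hZXR)).symm
        _ = exp (mlog (((dbarIterU (i + 1) (expCfg (((F.L : ℝ))⁻¹ ^ (K - n)) (A - H (D A))) c : (Matrix (Fin 2) (Fin 2) ℂ)ˣ) : Matrix (Fin 2) (Fin 2) ℂ))) := by
            rw [hl']
        _ = _ := exp_mlog (hsmall (A - H (D A)) hZAR)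
  -- (g) NEAR-FLATNESS under the `Ω`-blocks of every units field charted by a field of the `R`-ball on `Near`
  have hlev : ∀ (j : ℕ) (z : Site (F.P K) (j + 1)), z ∈ Dm.Om (j + 1) → j + 1 ≤ K - n := by
    intro j z hz
    rw [← hDk]
    by_contra hlt
    rw [Dm.Om_eq_empty (by omega)] at hz
    exact absurd hz (Finset.notMem_empty _)
  have hflatU : ∀ (Z : PBond (F.P K) 0 → Matrix (Fin 2) (Fin 2) ℂ), (∀ b, w 1 b * ‖Z b‖ < R) →
      ∀ (Yu : GaugeField (F.P K) 0 (Matrix (Fin 2) (Fin 2) ℂ)ˣ), (∀ b, Near b → Yu b = expCfg (((F.L : ℝ))⁻¹ ^ (K - n)) Z b) →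
      ∀ (j : ℕ) (z : Site (F.P K) (j + 1)), z ∈ Dm.Om (j + 1) → ∀ b : PBond (F.P K) 0, iterBlockOf (j + 1) b.src = z → iterBlockOf (j + 1) b.tgt = z →
        ‖((Yu b : (Matrix (Fin 2) (Fin 2) ℂ)ˣ) : Matrix (Fin 2) (Fin 2) ℂ) - 1‖ ≤ 2 * (max R 0 * ((F.L : ℝ))⁻¹ ^ (j + 1)) := by
    intro Z hZR Yu hYu j z hz b hs ht
    have hIn : Dm.InOm (j + 1) b.src := by show iterBlockOf (j + 1) b.src ∈ Dm.Om (j + 1); rw [hs]; exact hz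
    rw [hYu b (hNearΩ j z hz b hs ht), coe_expCfg]
    exact hchart (j + 1) (hlev j z hz) Z hZR b hIn
  have hs0 : ∀ j : ℕ, 0 ≤ 2 * (max R 0 * ((F.L : ℝ))⁻¹ ^ (j + 1)) := fun j => by positivity
  have hbudget : ∀ j : ℕ, 8 * 3800 * ((((F.P K).d + 2) * (F.P K).L : ℕ) : ℝ) ^ 2 * ((F.P K).L : ℝ) ^ (j + 1) * (2 * (max R 0 * ((F.L : ℝ))⁻¹ ^ (j + 1))) ≤ 1 := by
    intro j
    show 8 * 3800 * ((((F.P K).d + 2) * (F.P K).L : ℕ) : ℝ) ^ 2 * (F.L : ℝ) ^ (j + 1) * (2 * (max R 0 * ((F.L : ℝ))⁻¹ ^ (j + 1))) ≤ 1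
    have h1 : 8 * 3800 * ((((F.P K).d + 2) * (F.P K).L : ℕ) : ℝ) ^ 2 * (F.L : ℝ) ^ (j + 1) * (2 * (max R 0 * ((F.L : ℝ))⁻¹ ^ (j + 1))) =
        16 * 3800 * ((((F.P K).d + 2) * (F.P K).L : ℕ) : ℝ) ^ 2 * max R 0 * ((F.L : ℝ) ^ (j + 1) * ((F.L : ℝ))⁻¹ ^ (j + 1)) := by ring
    rw [h1, hLj, mul_one]
    have h2 : 16 * 3800 * ((((F.P K).d + 2) * (F.P K).L : ℕ) : ℝ) ^ 2 * max R 0 ≤ 16 * 3800 * ((((F.P K).d + 2) * (F.P K).L : ℕ) : ℝ) ^ 2 * max R 0 * (F.L : ℝ) :=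
      le_mul_of_one_le_right (by positivity) hL1
    linarith
  -- the minimiser: in the fibre, regular; its gauge copy is near-flat under the `Ω`-blocks
  have hUV : descendTo F ℰp n K hnK Umin = V := ((mem_regFibrePr_iff F).1 hUmin).1
  have hUreg : RegPr F n K ε₀ Umin := ((mem_regFibrePr_iff F).1 hUmin).2
  have hUs : ∀ (j : ℕ) (z : Site (F.P K) (j + 1)), z ∈ Dm.Om (j + 1) → ∀ b : PBond (F.P K) 0, iterBlockOf (j + 1) b.src = z → iterBlockOf (j + 1) b.tgt = z →
      ‖((GaugeField.gaugeAct uS Umin b : Matrix.specialUnitaryGroup (Fin 2) ℂ) : Matrix (Fin 2) (Fin 2) ℂ) - 1‖ ≤ 2 * (max R 0 * ((F.L : ℝ))⁻¹ ^ (j + 1)) := by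
    intro j z hz b hs ht
    rw [← coe_unitsField_toUField]
    exact hflatU (A - H (D A)) (hball A hAS) _ hAu j z hz b hs ht
  -- FILE B: the selector, the formula, the differentiability of the formula
  obtain ⟨hOf, Gm, hAB, hC⟩ := exists_gaugeOf_mem_fibre_smooth F n K hnK Dm hDk hε₀ hε Umin hUreg.plaqSmall uS
    (fun j => 2 * (max R 0 * ((F.L : ℝ))⁻¹ ^ (j + 1))) hs0 hbudget hUs
  -- the two B3 inputs of the real competitor `Wl t`, `|t| < r`
  have hidx_t : ∀ t : ℝ, |t| < r → ∀ idx : BondIdx Dm, dbarIterU (idx.1.1 : ℕ) (unitsField (toUField (Wl t))) idx.1.2 =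
      dbarIterU (idx.1.1 : ℕ) (unitsField (toUField (GaugeField.gaugeAct uS Umin))) idx.1.2 := fun t ht idx => by
    rw [hWlu t ht]; exact hidxτ (t : ℂ) (hgood_real t ht) idx
  have hWs_t : ∀ t : ℝ, |t| < r → ∀ (j : ℕ) (z : Site (F.P K) (j + 1)), z ∈ Dm.Om (j + 1) → ∀ b : PBond (F.P K) 0, iterBlockOf (j + 1) b.src = z →
      iterBlockOf (j + 1) b.tgt = z → ‖((Wl t b : Matrix.specialUnitaryGroup (Fin 2) ℂ) : Matrix (Fin 2) (Fin 2) ℂ) - 1‖ ≤ 2 * (max R 0 * ((F.L : ℝ))⁻¹ ^ (j + 1)) := by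
    intro t ht j z hz b hs hb
    rw [← coe_unitsField_toUField, hWlu t ht]
    exact hflatU (Zc (t : ℂ)) (hball (Xc (t : ℂ)) (hgood_real t ht)) (Wu (t : ℂ)) (fun b hb' => hWu_near _ b hb') j z hz b hs hb
  -- differentiability of the complex dressing and of the charted units field
  have hZc_diff : ∀ τ₀ : ℂ, (∀ b, w 1 b * ‖Xc τ₀ b‖ < r₁) → DifferentiableAt ℂ Zc τ₀ := by
    intro τ₀ hτ₀
    have hX : DifferentiableAt ℂ Xc τ₀ := (differentiableAt_const A).add (differentiableAt_id.smul_const Y)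
    have hH : DifferentiableAt ℂ (fun y : BondIdx Dm → Matrix (Fin 2) (Fin 2) ℂ => H y) (D (Xc τ₀)) := by
      have h := (LinearMap.toContinuousLinearMap H).differentiableAt (x := D (Xc τ₀))
      simpa using h
    exact hX.sub (hH.comp τ₀ ((hDd (Xc τ₀) hτ₀).comp τ₀ hX))
  have hWu_diff : ∀ τ₀ : ℂ, (∀ b, w 1 b * ‖Xc τ₀ b‖ < r₁) → ∀ b : PBond (F.P K) 0,
      DifferentiableAt ℂ (fun τ => ((Wu τ b : (Matrix (Fin 2) (Fin 2) ℂ)ˣ) : Matrix (Fin 2) (Fin 2) ℂ)) τ₀ := by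
    intro τ₀ hτ₀ b
    by_cases hb : Near b
    · have h : (fun τ => ((Wu τ b : (Matrix (Fin 2) (Fin 2) ℂ)ˣ) : Matrix (Fin 2) (Fin 2) ℂ)) =
          fun τ => ((expCfg (((F.L : ℝ))⁻¹ ^ (K - n)) (Zc τ) b : (Matrix (Fin 2) (Fin 2) ℂ)ˣ) : Matrix (Fin 2) (Fin 2) ℂ) := by
        funext τ; rw [hWu_near τ b hb]
      rw [h]
      exact (differentiableAt_coe_expCfg (((F.L : ℝ))⁻¹ ^ (K - n)) b (Zc τ₀)).comp τ₀ (hZc_diff τ₀ hτ₀)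
    · have h : (fun τ => ((Wu τ b : (Matrix (Fin 2) (Fin 2) ℂ)ˣ) : Matrix (Fin 2) (Fin 2) ℂ)) =
          fun _ => ((unitsField (toUField (GaugeField.gaugeAct uS Umin)) b : (Matrix (Fin 2) (Fin 2) ℂ)ˣ) : Matrix (Fin 2) (Fin 2) ℂ) := by
        funext τ; rw [hWu_far τ b hb]
      rw [h]
      exact differentiableAt_const _
  have hseg : ∀ t₀ : ℝ, |t₀| < r → ∀ᶠ t in 𝓝 t₀, |t| < r := fun t₀ ht₀ =>
    (isOpen_lt continuous_abs continuous_const).mem_nhds ht₀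
  have hgoodC : ∀ t₀ : ℝ, |t₀| < r → ∀ᶠ τ in 𝓝 (t₀ : ℂ), ∀ b, w 1 b * ‖Xc τ b‖ < r₁ := fun t₀ ht₀ =>
    hgood_open.mem_nhds (hgood_real t₀ ht₀)
  refine ⟨fun t => hOf (Wl t), fun t ht hreg => ?_, fun t₀ ht₀ z => ?_, fun t₀ ht₀ b => ?_⟩
  · -- (i) membership
    have h := ((hAB (Wl t) (hidx_t t ht) (hWs_t t ht)).2 hreg.plaqSmall)
    rwa [hUV] at h
  · -- (ii) the gauge family: `↑(hl t z) = Gm (Wu ↑t) z` near `t₀`, and `τ ↦ Gm (Wu τ) z` is ℂ-differentiable at `↑t₀`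
    have hev : (fun t : ℝ => ((hOf (Wl t) z : Matrix.specialUnitaryGroup (Fin 2) ℂ) : Matrix (Fin 2) (Fin 2) ℂ)) =ᶠ[𝓝 t₀]
        fun t : ℝ => Gm (Wu (t : ℂ)) z := by
      filter_upwards [hseg t₀ ht₀] with t ht
      rw [(hAB (Wl t) (hidx_t t ht) (hWs_t t ht)).1 z, hWlu t ht]
    have hCt : DifferentiableAt ℂ (fun τ => Gm (Wu τ) z) (t₀ : ℂ) :=
      hC Wu (t₀ : ℂ) (hWu_diff (t₀ : ℂ) (hgood_real t₀ ht₀)) (by filter_upwards [hgoodC t₀ ht₀] with τ hτ; exact hidxτ τ hτ)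
        (hflatU (Zc (t₀ : ℂ)) (hball (Xc (t₀ : ℂ)) (hgood_real t₀ ht₀)) (Wu (t₀ : ℂ)) fun b hb => hWu_near _ b hb) z
    exact hev.differentiableAt_iff.2 ((hCt.restrictScalars ℝ).comp t₀ Complex.ofRealCLM.differentiableAt)
  · -- (iii) the competitor line
    by_cases hb : Near b
    · have hev : (fun t : ℝ => ((Wl t b : Matrix.specialUnitaryGroup (Fin 2) ℂ) : Matrix (Fin 2) (Fin 2) ℂ)) =ᶠ[𝓝 t₀]
          fun t : ℝ => ((Wu (t : ℂ) b : (Matrix (Fin 2) (Fin 2) ℂ)ˣ) : Matrix (Fin 2) (Fin 2) ℂ) := by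
        filter_upwards [hseg t₀ ht₀] with t ht
        rw [← coe_unitsField_toUField, hWlu t ht]
      exact hev.differentiableAt_iff.2 (((hWu_diff (t₀ : ℂ) (hgood_real t₀ ht₀) b).restrictScalars ℝ).comp t₀ Complex.ofRealCLM.differentiableAt)
    · have h : (fun t : ℝ => ((Wl t b : Matrix.specialUnitaryGroup (Fin 2) ℂ) : Matrix (Fin 2) (Fin 2) ℂ)) =
          fun _ => ((GaugeField.gaugeAct uS Umin b : Matrix.specialUnitaryGroup (Fin 2) ℂ) : Matrix (Fin 2) (Fin 2) ℂ) := by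
        funext t; rw [hWfar t b hb]
      rw [h]
      exact differentiableAt_const _

end Summit.QuantumFields.YangMills.Theorems.HalvingCompetitorMapFibreSmooth

end
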